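import Literature.Probability.RandomPlanarGeometry.USTPeanoPath
import Literature.Probability.RandomPlanarGeometry.USTPeanoGrid
import Literature.Probability.RandomPlanarGeometry.BoundaryCycle
import Mathlib.Analysis.Complex.Convex
import HarnessLib

/-!
# A UST Peano path runs inside its domain and is a simple curve ([LSW04] §4.1–4.2)

G. F. Lawler, O. Schramm, W. Werner, Ann. Probab. **32** (2004), pp. 971–973: the UST Peano
path of `D = D(α, β, a, b) ∈ 𝔇*` is an "oriented path in `G⃗ ∩ D̄` from `a` to `b`", and §4.2
applies to it "the conformal map `φ : D → ℍ`", i.e. treats `γ` minus its endpoints as a simple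
curve INSIDE `D`. For the tree's combinatorial `USTPeano.PeanoPath` (vertices `{a, b} ∪ V_P(D)`,
edges of `G⃗` avoiding `α ∪ β`) and its polygonal parametrisation `PeanoPath.curve` on
`[0, ℓ + 1]` this file PROVES:

* `PeanoPath.curve_mem_carrier` — **`γ(s) ∈ D` for `0 < s < ℓ + 1`**: the open path avoids the
  boundary polygon `a, α, b, β⁻¹` (its edges avoid `α ∪ β` by definition and meet the connecting
  half-diagonals at `a`, `b` only at `a`, `b`, `USTPeanoGrid`), and it meets `D` — the midpoint of
  the first edge is joined to LSW's orientation test point `rightTestPt a ∈ D` by a segment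
  inside the disc `B(a, ¼)`, which the boundary polygon crosses only along the diagonal
  `[α_a, β_a]` (`Domain.im_mul_conj_eq_zero_of_mem_frontier_near_a`), on whose right both lie
  ([LSW04] p. 971, "`D` lies to the immediate right of `[α_a, β_a]`");
* `PeanoPath.injOn_curve` — **the path is a simple curve on `[0, ℓ + 1]`** (distinct vertices,
  and two edges of `G` meet only in a common endpoint);
* `PeanoPath.exists_halfDisc_at_b` — **the local picture at `b`**: `D` contains the open
  half-disc of radius `¼` at `b` on the side of the last edge, its diameter lies on `∂D` and avoids
  `a`, and on `[ℓ, ℓ + 1]` the path is the straight segment `b + (ℓ + 1 - s) ρ d` with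
  `im d > 0` — the hypotheses of
  `MarkedDomain.IsChordalUniformizing.tendsto_im_symm_atTop` (`ChordalCapacityDivergence`),
  which makes the capacity parametrisation of `φ⁻¹ ∘ γ` run over all of `[0, ∞)`
  ([LSW04] Thm. 4.4, `LSW2004USTProofs`).

## References

* G. F. Lawler, O. Schramm, W. Werner (2004), §4.1 (pp. 970–972), §4.2 (p. 973) [LawlerSchrammWerner2004].
-/

noncomputable section

open Set Complex Function Metric
open scoped ComplexConjugate

namespace Literature.Probability.RandomPlanarGeometry

namespace USTPeano

/-! ### Lists: consecutive pairs -/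

/-- The consecutive pair `(l[i], l[i+1])` is in `l.zip l.tail`. [folklore] -/
theorem getElem_pair_mem_zip_tail {X : Type*} (l : List X) (i : ℕ) (hi : i + 1 < l.length) :
    (l[i], l[i + 1]) ∈ l.zip l.tail := by
  have hlen : i < (l.zip l.tail).length := by simp; omega
  have h : (l.zip l.tail)[i] = (l[i], l[i + 1]) := by simp [List.getElem_zip, List.getElem_tail]
  rw [← h]
  exact List.getElem_mem hlen

/-- A chain relation holds along every pair of `l.zip l.tail`. [folklore] -/
theorem rel_of_mem_zip_tail {X : Type*} {R : X → X → Prop} {l : List X} (hc : l.IsChain R)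
    {e : X × X} (he : e ∈ l.zip l.tail) : R e.1 e.2 := by
  obtain ⟨i, hi, rfl⟩ := List.mem_iff_getElem.1 he
  have hi' : i + 1 < l.length := by simp at hi; omega
  simp only [List.getElem_zip, List.getElem_tail]
  exact hc.getElem i hi'

/-- A list is a chain for the relation "consecutive in the list". [folklore] -/
theorem isChain_mem_zip_tail {X : Type*} (l : List X) : l.IsChain (fun u v ↦ (u, v) ∈ l.zip l.tail) :=
  List.isChain_iff_getElem.2 fun i hi ↦ getElem_pair_mem_zip_tail l i hi

/-! ### The boundary polygon: the frontier edge by edge -/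

namespace Domain

variable (Δ : Domain)

/-- **The frontier of `D` edge by edge**: a property of all points of the six kinds of edges of
the boundary polygon `a, α_a, …, α_b, b, β_b, …, β_a` — (1) `[a, α_a]`, (2) the edges of `α`,
(3) `[α_b, b]`, (4) `[b, β_b]`, (5) the edges of `β` (backwards), (6) `[β_a, a]` — holds on the
whole frontier of `D` (`range_polygonLoop`, `boundaryVerts_cyclic'`). [cite: LawlerSchrammWerner2004, §4.1] -/
theorem forall_mem_frontier {P : ℂ → Prop}
    (h1 : ∀ z ∈ segment ℝ (peanoPt Δ.a) (primalPt (primalNbr Δ.a)), P z)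
    (h2 : ∀ e ∈ Δ.α.zip Δ.α.tail, ∀ z ∈ segment ℝ (primalPt e.1) (primalPt e.2), P z)
    (h3 : ∀ z ∈ segment ℝ (primalPt (primalNbr Δ.b)) (peanoPt Δ.b), P z)
    (h4 : ∀ z ∈ segment ℝ (peanoPt Δ.b) (dualPt (dualNbr Δ.b)), P z)
    (h5 : ∀ e ∈ Δ.β.zip Δ.β.tail, ∀ z ∈ segment ℝ (dualPt e.2) (dualPt e.1), P z)
    (h6 : ∀ z ∈ segment ℝ (dualPt (dualNbr Δ.a)) (peanoPt Δ.a), P z) :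
    ∀ z ∈ frontier Δ.carrier, P z := by
  intro z hz
  have hne : boundaryVerts Δ.α Δ.β Δ.a Δ.b ≠ [] := by simp [boundaryVerts]
  rw [Δ.frontier_carrier, range_polygonLoop hne] at hz
  obtain ⟨k, hk⟩ := mem_iUnion.1 hz
  have key := boundaryVerts_cyclic' (R := fun u v ↦ ∀ z ∈ segment ℝ u v, P z) Δ.α_ne_nil Δ.β_ne_nil
    (by rw [Δ.head_α]; exact h1)
    ((isChain_mem_zip_tail Δ.α).imp fun u v huv ↦ h2 (u, v) huv)
    (by rw [Δ.getLast_α]; exact h3) (by rw [Δ.getLast_β]; exact h4)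
    ((isChain_mem_zip_tail Δ.β).imp fun u v huv ↦ h5 (u, v) huv)
    (by rw [Δ.head_β]; exact h6) k k.2
  exact key z hk

/-- A point of the half-diagonal `[p, α_p]` (primal half) gives a real multiple:
`(z - p) conj(β_p - α_p)` has zero imaginary part; same for `[p, β_p]`. [folklore] -/
theorem im_mul_conj_eq_zero_of_mem_halfDiag (p : ℤ × ℤ) {z : ℂ}
    (hz : z ∈ segment ℝ (peanoPt p) (primalPt (primalNbr p)) ∨ z ∈ segment ℝ (peanoPt p) (dualPt (dualNbr p))) :
    ((z - peanoPt p) * conj (dualPt (dualNbr p) - primalPt (primalNbr p))).im = 0 := by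
  set m : ℂ := dualPt (dualNbr p) - primalPt (primalNbr p) with hm
  rcases hz with hz | hz
  · obtain ⟨t, -, -, rfl⟩ := exists_of_mem_segment hz
    have h1 : primalPt (primalNbr p) - peanoPt p = -(m / 2) := by
      rw [hm, ← peanoPt_sub_primalPt_eq]; ring
    rw [add_sub_cancel_left, h1, show (t : ℂ) * -(m / 2) * conj m = -((t / 2 : ℝ) : ℂ) * (m * conj m) by
      push_cast; ring, Complex.mul_conj]
    norm_cast
  · obtain ⟨t, -, -, rfl⟩ := exists_of_mem_segment hz
    have h1 : dualPt (dualNbr p) - peanoPt p = m / 2 := by rw [hm, ← dualPt_sub_peanoPt_eq]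
    rw [add_sub_cancel_left, h1, show (t : ℂ) * (m / 2) * conj m = ((t / 2 : ℝ) : ℂ) * (m * conj m) by
      push_cast; ring, Complex.mul_conj]
    norm_cast

/-- **The boundary near `a` is the diagonal `[α_a, β_a]`**: a frontier point of `D` at distance
`< ¼` from `a` lies on the line through `α_a`, `β_a` (all other edges of the boundary polygon are
`¼`-far from `a`, `USTPeanoGrid`). [cite: LawlerSchrammWerner2004, §4.1] -/
theorem im_mul_conj_eq_zero_of_mem_frontier_near_a {z : ℂ} (hz : z ∈ frontier Δ.carrier)
    (hd : dist z (peanoPt Δ.a) < 1 / 4) :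
    ((z - peanoPt Δ.a) * conj (dualPt (dualNbr Δ.a) - primalPt (primalNbr Δ.a))).im = 0 := by
  revert hd
  refine Δ.forall_mem_frontier (P := fun z ↦ dist z (peanoPt Δ.a) < 1 / 4 →
    ((z - peanoPt Δ.a) * conj (dualPt (dualNbr Δ.a) - primalPt (primalNbr Δ.a))).im = 0)
    ?_ ?_ ?_ ?_ ?_ ?_ z hz
  · exact fun z hz _ ↦ im_mul_conj_eq_zero_of_mem_halfDiag Δ.a (Or.inl hz)
  · intro e he z hz hd
    exact absurd hd (not_lt.2 (quarter_le_dist_peanoPt_of_mem_primalEdge (rel_of_mem_zip_tail Δ.isChain_α he) Δ.a hz))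
  · intro z hz hd
    rw [segment_symm] at hz
    exact absurd hd (not_lt.2 (quarter_le_dist_peanoPt_of_mem_halfDiag Δ.a_ne_b (abs_primalPt_sub_peanoPt Δ.b) hz))
  · intro z hz hd
    exact absurd hd (not_lt.2 (quarter_le_dist_peanoPt_of_mem_halfDiag Δ.a_ne_b (abs_dualPt_sub_peanoPt Δ.b) hz))
  · intro e he z hz hd
    rw [segment_symm] at hz
    exact absurd hd (not_lt.2 (quarter_le_dist_peanoPt_of_mem_dualEdge (rel_of_mem_zip_tail Δ.isChain_β he) Δ.a hz))
  · intro z hz _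
    rw [segment_symm] at hz
    exact im_mul_conj_eq_zero_of_mem_halfDiag Δ.a (Or.inr hz)

/-- **The boundary near `b` is the diagonal `[α_b, β_b]`.** [cite: LawlerSchrammWerner2004, §4.1] -/
theorem im_mul_conj_eq_zero_of_mem_frontier_near_b {z : ℂ} (hz : z ∈ frontier Δ.carrier)
    (hd : dist z (peanoPt Δ.b) < 1 / 4) :
    ((z - peanoPt Δ.b) * conj (dualPt (dualNbr Δ.b) - primalPt (primalNbr Δ.b))).im = 0 := by
  revert hd
  refine Δ.forall_mem_frontier (P := fun z ↦ dist z (peanoPt Δ.b) < 1 / 4 →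
    ((z - peanoPt Δ.b) * conj (dualPt (dualNbr Δ.b) - primalPt (primalNbr Δ.b))).im = 0)
    ?_ ?_ ?_ ?_ ?_ ?_ z hz
  · intro z hz hd
    exact absurd hd (not_lt.2 (quarter_le_dist_peanoPt_of_mem_halfDiag Δ.a_ne_b.symm (abs_primalPt_sub_peanoPt Δ.a) hz))
  · intro e he z hz hd
    exact absurd hd (not_lt.2 (quarter_le_dist_peanoPt_of_mem_primalEdge (rel_of_mem_zip_tail Δ.isChain_α he) Δ.b hz))
  · intro z hz _
    rw [segment_symm] at hz
    exact im_mul_conj_eq_zero_of_mem_halfDiag Δ.b (Or.inl hz)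
  · exact fun z hz _ ↦ im_mul_conj_eq_zero_of_mem_halfDiag Δ.b (Or.inr hz)
  · intro e he z hz hd
    rw [segment_symm] at hz
    exact absurd hd (not_lt.2 (quarter_le_dist_peanoPt_of_mem_dualEdge (rel_of_mem_zip_tail Δ.isChain_β he) Δ.b hz))
  · intro z hz hd
    rw [segment_symm] at hz
    exact absurd hd (not_lt.2 (quarter_le_dist_peanoPt_of_mem_halfDiag Δ.a_ne_b.symm (abs_dualPt_sub_peanoPt Δ.a) hz))

/-- The two half-diagonals at `b` lie on the frontier of `D`. [cite: LawlerSchrammWerner2004, §4.1] -/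
theorem halfDiag_b_subset_frontier :
    segment ℝ (primalPt (primalNbr Δ.b)) (peanoPt Δ.b) ∪ segment ℝ (peanoPt Δ.b) (dualPt (dualNbr Δ.b)) ⊆
      frontier Δ.carrier := by
  have hne : boundaryVerts Δ.α Δ.β Δ.a Δ.b ≠ [] := by simp [boundaryVerts]
  rw [Δ.frontier_carrier, range_polygonLoop hne]
  set V := boundaryVerts Δ.α Δ.β Δ.a Δ.b with hV
  have hlen : V.length = Δ.α.length + Δ.β.length + 2 := length_boundaryVerts _ _ _ _
  have hα : 1 ≤ Δ.α.length := List.length_pos_iff.2 Δ.α_ne_nil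
  have hβ : 1 ≤ Δ.β.length := List.length_pos_iff.2 Δ.β_ne_nil
  -- the vertices `α_b` (index `|α|`), `b` (index `|α| + 1`), `β_b` (index `|α| + 2`)
  have hk1 : Δ.α.length < V.length := by omega
  have hk2 : Δ.α.length + 1 < V.length := by omega
  have hk3 : Δ.α.length + 2 < V.length := by omega
  have hV1 : V[Δ.α.length] = primalPt (primalNbr Δ.b) := by
    rw [← Δ.getLast_α, List.getLast_eq_getElem]
    have hidx : Δ.α.length = (Δ.α.length - 1) + 1 := by omega
    simp only [hV, boundaryVerts]
    rw [getElem_congr_idx hidx, List.getElem_cons_succ, List.getElem_append_left (by simp; omega),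
      List.getElem_map]
  have hV2 : V[Δ.α.length + 1] = peanoPt Δ.b := boundaryVerts_length_succ _ _ _ _
  have hV3 : V[Δ.α.length + 2] = dualPt (dualNbr Δ.b) := by
    rw [← Δ.getLast_β]
    have h1 : (Δ.α.map primalPt).length ≤ Δ.α.length + 1 := by simp
    simp only [hV, boundaryVerts]
    rw [List.getElem_cons_succ, List.getElem_append_right (by simp)]
    simp [List.getElem_reverse, List.getLast_eq_getElem]
  have hmod2 : (Δ.α.length + 1) % V.length = Δ.α.length + 1 := Nat.mod_eq_of_lt hk2
  have hmod3 : (Δ.α.length + 1 + 1) % V.length = Δ.α.length + 2 := Nat.mod_eq_of_lt (by omega)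
  rintro z (hz | hz)
  · refine mem_iUnion.2 ⟨⟨Δ.α.length, hk1⟩, ?_⟩
    have e1 : V[((⟨Δ.α.length, hk1⟩ : Fin V.length) : ℕ)] = primalPt (primalNbr Δ.b) := hV1
    have e2 : V[(((⟨Δ.α.length, hk1⟩ : Fin V.length) : ℕ) + 1) % V.length]'(Nat.mod_lt _ (by omega)) =
        peanoPt Δ.b := by
      rw [← hV2]; exact getElem_congr_idx hmod2
    rw [e1, e2]; exact hz
  · refine mem_iUnion.2 ⟨⟨Δ.α.length + 1, hk2⟩, ?_⟩
    have e1 : V[((⟨Δ.α.length + 1, hk2⟩ : Fin V.length) : ℕ)] = peanoPt Δ.b := hV2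
    have e2 : V[(((⟨Δ.α.length + 1, hk2⟩ : Fin V.length) : ℕ) + 1) % V.length]'(Nat.mod_lt _ (by omega)) =
        dualPt (dualNbr Δ.b) := by
      rw [← hV3]; exact getElem_congr_idx hmod3
    rw [e1, e2]; exact hz

/-- A preconnected set missing the frontier of `D` and meeting `D` lies in `D`. [folklore] -/
theorem subset_carrier_of_isPreconnected {S : Set ℂ} (hS : IsPreconnected S)
    (hSf : Disjoint S (frontier Δ.carrier)) {z : ℂ} (hzS : z ∈ S) (hz : z ∈ Δ.carrier) :
    S ⊆ Δ.carrier := by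
  have hsub : S ⊆ Δ.carrier ∪ (closure Δ.carrier)ᶜ := by
    intro w hw
    by_contra hw'
    simp only [mem_union, mem_compl_iff, not_or, not_not] at hw'
    refine Set.disjoint_left.1 hSf hw ⟨hw'.2, ?_⟩
    rw [Δ.isOpen_carrier.interior_eq]
    exact hw'.1
  exact hS.subset_left_of_subset_union Δ.isOpen_carrier isClosed_closure.isOpen_compl
    (Set.disjoint_left.2 fun w hw hw' ↦ hw' (subset_closure hw)) hsub ⟨z, hzS, hz⟩

end Domain

/-! ### The path: edges, vertices, parametrisation -/

namespace PeanoPath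

variable {Δ : Domain} (γ : PeanoPath Δ)

/-- `0 < ℓ + 1`. [folklore] -/
theorem tlen_pos : 0 < γ.tlen := by
  have := γ.two_le_length
  rw [← γ.tlen_add_one] at this
  omega

/-- The number of vertices is `tlen + 1`. [folklore] -/
theorem length_verts_eq : γ.verts.length = γ.tlen + 1 := γ.tlen_add_one.symm

/-- Vertex `0` is `a`. [folklore] -/
theorem getElem_zero : γ.verts[0]'(List.length_pos_iff.2 γ.ne_nil) = Δ.a := by
  rw [← γ.head_eq, List.head_eq_getElem]

/-- Vertex `tlen` is `b`. [folklore] -/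
theorem getElem_tlen : γ.verts[γ.tlen]'(by rw [γ.length_verts_eq]; exact Nat.lt_succ_self _) = Δ.b := by
  rw [← γ.getLast_eq, List.getLast_eq_getElem]
  exact getElem_congr_idx (by rw [γ.length_verts_eq]; rfl)

/-- A vertex is `a` iff it is vertex `0` (no repeated vertices). [folklore] -/
theorem getElem_eq_a_iff {k : ℕ} (hk : k < γ.verts.length) : γ.verts[k] = Δ.a ↔ k = 0 := by
  rw [← γ.getElem_zero, γ.nodup.getElem_inj_iff]

/-- A vertex is `b` iff it is vertex `tlen`. [folklore] -/
theorem getElem_eq_b_iff {k : ℕ} (hk : k < γ.verts.length) : γ.verts[k] = Δ.b ↔ k = γ.tlen := by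
  rw [← γ.getElem_tlen, γ.nodup.getElem_inj_iff]

/-- Consecutive vertices are joined by a Manhattan edge. [folklore] -/
theorem manhattan_getElem {k : ℕ} (hk : k + 1 < γ.verts.length) : Manhattan γ.verts[k] γ.verts[k + 1] :=
  γ.isChain.getElem k hk

/-- Consecutive vertices are at distance `½`; in particular distinct as points. [folklore] -/
theorem peanoPt_getElem_ne {k : ℕ} (hk : k + 1 < γ.verts.length) :
    peanoPt γ.verts[k] ≠ peanoPt γ.verts[k + 1] := by
  intro h
  have := dist_peanoPt_of_manhattan (γ.manhattan_getElem hk)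
  rw [h, dist_self] at this
  norm_num at this

/-- **The edges avoid the boundary except at `a`, `b`**: a point of the `k`-th edge lying on the
frontier of `D` is `a` or `b`, and then `a` resp. `b` is an endpoint of that edge (the edges
avoid `α ∪ β` by definition of a Peano path, and meet the connecting half-diagonals only at their
Peano endpoint, `eq_of_mem_halfDiag_of_mem_peanoEdge`). [cite: LawlerSchrammWerner2004, §4.1] -/
theorem eq_of_mem_edge_of_mem_frontier {k : ℕ} (hk : k + 1 < γ.verts.length) {z : ℂ}
    (hz : z ∈ segment ℝ (peanoPt γ.verts[k]) (peanoPt γ.verts[k + 1])) (hfr : z ∈ frontier Δ.carrier) :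
    (z = peanoPt Δ.a ∧ (Δ.a = γ.verts[k] ∨ Δ.a = γ.verts[k + 1])) ∨
      (z = peanoPt Δ.b ∧ (Δ.b = γ.verts[k] ∨ Δ.b = γ.verts[k + 1])) := by
  have hM := γ.manhattan_getElem hk
  have hdisj := γ.disjoint_edge _ (getElem_pair_mem_zip_tail γ.verts k hk)
  simp only at hdisj
  revert hz
  refine Δ.forall_mem_frontier (P := fun z ↦ z ∈ segment ℝ (peanoPt γ.verts[k]) (peanoPt γ.verts[k + 1]) →
    (z = peanoPt Δ.a ∧ (Δ.a = γ.verts[k] ∨ Δ.a = γ.verts[k + 1])) ∨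
      (z = peanoPt Δ.b ∧ (Δ.b = γ.verts[k] ∨ Δ.b = γ.verts[k + 1]))) ?_ ?_ ?_ ?_ ?_ ?_ z hfr
  · intro z hz1 hz2
    exact Or.inl (eq_of_mem_halfDiag_of_mem_peanoEdge (abs_primalPt_sub_peanoPt Δ.a) hM hz1 hz2)
  · intro e he z hz1 hz2
    refine absurd ?_ (Set.disjoint_left.1 hdisj hz2)
    exact Or.inl (Or.inr (mem_iUnion₂.2 ⟨e, he, hz1⟩))
  · intro z hz1 hz2
    rw [segment_symm] at hz1
    exact Or.inr (eq_of_mem_halfDiag_of_mem_peanoEdge (abs_primalPt_sub_peanoPt Δ.b) hM hz1 hz2)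
  · intro z hz1 hz2
    exact Or.inr (eq_of_mem_halfDiag_of_mem_peanoEdge (abs_dualPt_sub_peanoPt Δ.b) hM hz1 hz2)
  · intro e he z hz1 hz2
    refine absurd ?_ (Set.disjoint_left.1 hdisj hz2)
    rw [segment_symm] at hz1
    exact Or.inr (Or.inr (mem_iUnion₂.2 ⟨e, he, hz1⟩))
  · intro z hz1 hz2
    rw [segment_symm] at hz1
    exact Or.inl (eq_of_mem_halfDiag_of_mem_peanoEdge (abs_dualPt_sub_peanoPt Δ.a) hM hz1 hz2)

/-- **The path on its `k`-th edge**: `γ(s) = lineMap w_k w_{k+1} (s - k)` for `s ∈ [k, k + 1]`.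
[folklore] -/
theorem curve_eq_lineMap {k : ℕ} (hk : k + 1 < γ.verts.length) {s : ℝ} (hs : s ∈ Icc (k : ℝ) (k + 1)) :
    γ.curve s = AffineMap.lineMap (peanoPt γ.verts[k]) (peanoPt γ.verts[k + 1]) (s - k) := by
  have hk' : k + 1 < (γ.verts.map peanoPt).length := by simpa using hk
  rw [curve, affineInterp_eq_lineMap _ k hk' hs]
  simp

/-- The path on its `k`-th edge lies on the segment `[w_k, w_{k+1}]`. [folklore] -/
theorem curve_mem_segment {k : ℕ} (hk : k + 1 < γ.verts.length) {s : ℝ} (hs : s ∈ Icc (k : ℝ) (k + 1)) :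
    γ.curve s ∈ segment ℝ (peanoPt γ.verts[k]) (peanoPt γ.verts[k + 1]) := by
  rw [γ.curve_eq_lineMap hk hs, segment_eq_image_lineMap]
  exact ⟨s - k, ⟨by linarith [hs.1], by linarith [hs.2]⟩, rfl⟩

/-- The parameter of an edge point: `lineMap x y θ = x` forces `θ = 0` (`x ≠ y`). [folklore] -/
theorem eq_zero_of_lineMap_eq_left {x y : ℂ} (hxy : x ≠ y) {θ : ℝ} (h : AffineMap.lineMap x y θ = x) :
    θ = 0 := by
  rw [AffineMap.lineMap_apply_module', add_eq_right, smul_eq_zero] at h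
  exact h.resolve_right (sub_ne_zero.2 hxy.symm)

/-- The parameter of an edge point: `lineMap x y θ = y` forces `θ = 1` (`x ≠ y`). [folklore] -/
theorem eq_one_of_lineMap_eq_right {x y : ℂ} (hxy : x ≠ y) {θ : ℝ} (h : AffineMap.lineMap x y θ = y) :
    θ = 1 := by
  have h' : (θ - 1) • (y - x) = 0 := by
    rw [AffineMap.lineMap_apply_module'] at h
    rw [sub_smul, one_smul, sub_eq_zero]
    exact eq_sub_of_add_eq h
  rw [smul_eq_zero] at h'
  linarith [h'.resolve_right (sub_ne_zero.2 hxy.symm)]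

/-- The edge index of a time `s ∈ (0, ℓ + 1)`: `k = ⌊s⌋` with `s ∈ [k, k + 1]`, `k + 1 ≤ ℓ + 1`.
[folklore] -/
theorem exists_edge_index {s : ℝ} (hs : s ∈ Ioo (0 : ℝ) γ.tlen) :
    ∃ k : ℕ, k + 1 < γ.verts.length ∧ s ∈ Icc (k : ℝ) (k + 1) := by
  have hs0 : 0 ≤ s := hs.1.le
  refine ⟨⌊s⌋₊, ?_, Nat.floor_le hs0, (Nat.lt_floor_add_one s).le⟩
  rw [γ.length_verts_eq]
  have : ⌊s⌋₊ < γ.tlen := (Nat.floor_lt hs0).2 hs.2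
  omega

/-- **The open path misses the boundary**: `γ(s) ∉ ∂D` for `0 < s < ℓ + 1`. [cite: LawlerSchrammWerner2004, §4.1] -/
theorem curve_notMem_frontier {s : ℝ} (hs : s ∈ Ioo (0 : ℝ) γ.tlen) : γ.curve s ∉ frontier Δ.carrier := by
  intro hfr
  obtain ⟨k, hk, hsk⟩ := γ.exists_edge_index hs
  have hne := γ.peanoPt_getElem_ne hk
  have hlen := γ.length_verts_eq
  rcases γ.eq_of_mem_edge_of_mem_frontier hk (γ.curve_mem_segment hk hsk) hfr with
    ⟨hz, ha | ha⟩ | ⟨hz, hb | hb⟩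
  · have hk0 : k = 0 := (γ.getElem_eq_a_iff (by omega)).1 ha.symm
    subst hk0
    rw [γ.curve_eq_lineMap hk hsk] at hz
    rw [ha] at hz
    have := eq_zero_of_lineMap_eq_left hne hz
    simp at this
    linarith [hs.1]
  · have := (γ.getElem_eq_a_iff hk).1 ha.symm
    omega
  · have := (γ.getElem_eq_b_iff (by omega)).1 hb.symm
    omega
  · have hk1 : k + 1 = γ.tlen := (γ.getElem_eq_b_iff hk).1 hb.symm
    rw [γ.curve_eq_lineMap hk hsk] at hz
    rw [hb] at hz
    have := eq_one_of_lineMap_eq_right hne hz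
    have : s = γ.tlen := by
      rw [← hk1]; push_cast; linarith
    linarith [hs.2]

/-- **The midpoint of the first edge lies in `D`.** With `q = rightTestPt a ∈ D` ([LSW04]
p. 971: `D` is immediately to the right of `[α_a, β_a]`) and `M = (a + w₁)/2`: every point
`z ≠ M` of `[q, M]` has `|z - a| < ¼`, hence is a frontier point only if it lies on the line
`α_a β_a` (`im_mul_conj_eq_zero_of_mem_frontier_near_a`) — but `im ((z - a) conj(β_a - α_a))`
is the constant `-⅛ < 0` along `[q, M]` (`im_manhattan_step_mul_conj_diag`); and `M` itself is
off the frontier (`curve_notMem_frontier`). So the segment `[q, M]` misses `∂D`, starts in `D`,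
hence ends in `D`. [cite: LawlerSchrammWerner2004, §4.1] -/
theorem curve_half_mem_carrier : γ.curve (1 / 2) ∈ Δ.carrier := by
  have hlen := γ.length_verts_eq
  have h1 : 0 + 1 < γ.verts.length := by have := γ.two_le_length; omega
  set pa : ℂ := peanoPt Δ.a with hpa
  set m : ℂ := dualPt (dualNbr Δ.a) - primalPt (primalNbr Δ.a) with hm
  set w₁ : ℤ × ℤ := γ.verts[1] with hw₁
  have hM : Manhattan Δ.a w₁ := by
    have := γ.manhattan_getElem h1
    rwa [γ.getElem_zero] at this
  set M : ℂ := γ.curve (1 / 2) with hMdef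
  have hMeq : M = pa + (1 / 2 : ℂ) * (peanoPt w₁ - pa) := by
    rw [hMdef, γ.curve_eq_lineMap h1 (s := 1 / 2) ⟨by norm_num, by norm_num⟩, γ.getElem_zero,
      AffineMap.lineMap_apply_module', Complex.real_smul]
    push_cast
    ring
  set q : ℂ := rightTestPt Δ.a with hq
  have hqD : q ∈ Δ.carrier := Δ.rightTestPt_mem
  have hqeq : q = pa + (1 / 4 : ℂ) * (-I * m) := rfl
  -- the side functional is `-1/8` at `q` and at `M`
  have hnm : m * conj m = ((1 / 2 : ℝ) : ℂ) := by
    rw [Complex.mul_conj, hm, normSq_dualPt_sub_primalPt]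
  have hside_q : ((q - pa) * conj m).im = -(1 / 8) := by
    rw [hqeq, add_sub_cancel_left, show (1 / 4 : ℂ) * (-I * m) * conj m = -(I / 4) * (m * conj m) by ring,
      hnm]
    simp
    norm_num
  have hside_M : ((M - pa) * conj m).im = -(1 / 8) := by
    rw [hMeq, add_sub_cancel_left, mul_assoc, show (1 / 2 : ℂ) = ((1 / 2 : ℝ) : ℂ) by push_cast; ring,
      im_ofReal_mul, im_manhattan_step_mul_conj_diag hM]
    norm_num
  -- distances from `a`
  have hnorm_m : ‖m‖ < 1 := by
    have : ‖m‖ ^ 2 = 1 / 2 := by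
      rw [← Complex.normSq_eq_norm_sq, hm, normSq_dualPt_sub_primalPt]
    nlinarith [norm_nonneg m]
  have hdq : dist q pa < 1 / 4 := by
    rw [dist_eq_norm, hqeq, add_sub_cancel_left, norm_mul, norm_mul, norm_neg, norm_I, one_mul]
    norm_num
    linarith
  have hdM : dist M pa = 1 / 4 := by
    rw [dist_eq_norm, hMeq, add_sub_cancel_left, norm_mul, ← dist_eq_norm, dist_comm,
      dist_peanoPt_of_manhattan hM]
    norm_num
  -- the segment `[q, M]` misses the frontier
  have hseg : Disjoint (segment ℝ q M) (frontier Δ.carrier) := by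
    rw [Set.disjoint_left]
    intro z hz hzf
    obtain ⟨t, ht0, ht1, rfl⟩ := exists_of_mem_segment hz
    rcases ht1.lt_or_eq with ht1 | rfl
    · -- `z ≠ M`: inside `B(a, 1/4)`, strictly right of the diagonal
      have hd : dist (q + t * (M - q)) pa < 1 / 4 := by
        have hexpr : q + t * (M - q) - pa = ((1 - t : ℝ) : ℂ) * (q - pa) + (t : ℂ) * (M - pa) := by
          push_cast; ring
        rw [dist_eq_norm, hexpr]
        calc ‖((1 - t : ℝ) : ℂ) * (q - pa) + (t : ℂ) * (M - pa)‖
            ≤ ‖((1 - t : ℝ) : ℂ) * (q - pa)‖ + ‖(t : ℂ) * (M - pa)‖ := norm_add_le _ _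
          _ = (1 - t) * dist q pa + t * dist M pa := by
              rw [norm_mul, norm_mul, norm_real, norm_real, Real.norm_eq_abs, Real.norm_eq_abs,
                abs_of_nonneg (by linarith), abs_of_nonneg ht0, dist_eq_norm, dist_eq_norm]
          _ < (1 - t) * (1 / 4) + t * (1 / 4) := by
              rw [hdM]
              have : 0 < 1 - t := by linarith
              nlinarith
          _ = 1 / 4 := by ring
      have h0 := Δ.im_mul_conj_eq_zero_of_mem_frontier_near_a hzf hd
      have hexpr : (q + t * (M - q) - pa) * conj m =
          ((1 - t : ℝ) : ℂ) * ((q - pa) * conj m) + (t : ℂ) * ((M - pa) * conj m) := by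
        push_cast; ring
      rw [hexpr, add_im, im_ofReal_mul, im_ofReal_mul, hside_q, hside_M] at h0
      linarith
    · -- `z = M`
      have hM' : q + (1 : ℝ) * (M - q) = M := by push_cast; ring
      rw [hM'] at hzf
      have htlen : (1 : ℝ) ≤ γ.tlen := by exact_mod_cast γ.tlen_pos
      exact γ.curve_notMem_frontier ⟨by norm_num, by linarith⟩ hzf
  have hsub := Δ.subset_carrier_of_isPreconnected (convex_segment q M).isPreconnected hseg
    (left_mem_segment ℝ q M) hqD
  exact hsub (right_mem_segment ℝ q M)

/-- **The open Peano path runs inside `D`**: `γ(s) ∈ D` for `0 < s < ℓ + 1` (the image of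
`(0, ℓ + 1)` is connected, misses `∂D`, and contains the midpoint of the first edge, which is in
`D`). [LSW04] pp. 971–973 ("oriented paths in `G⃗ ∩ D̄` from `a` to `b`"; `φ : D → ℍ` is applied
to `γ`). [cite: LawlerSchrammWerner2004, §4.1] -/
theorem curve_mem_carrier {s : ℝ} (hs : s ∈ Ioo (0 : ℝ) γ.tlen) : γ.curve s ∈ Δ.carrier := by
  have htlen : (1 : ℝ) ≤ γ.tlen := by exact_mod_cast γ.tlen_pos
  have hhalf : (1 / 2 : ℝ) ∈ Ioo (0 : ℝ) γ.tlen := ⟨by norm_num, by linarith⟩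
  have hS : IsPreconnected (γ.curve '' Ioo (0 : ℝ) γ.tlen) :=
    isPreconnected_Ioo.image _ γ.continuous_curve.continuousOn
  have hSf : Disjoint (γ.curve '' Ioo (0 : ℝ) γ.tlen) (frontier Δ.carrier) := by
    rw [Set.disjoint_left]
    rintro _ ⟨s', hs', rfl⟩
    exact γ.curve_notMem_frontier hs'
  exact Δ.subset_carrier_of_isPreconnected hS hSf (mem_image_of_mem _ hhalf) γ.curve_half_mem_carrier
    (mem_image_of_mem _ hs)

/-- **The Peano path is a simple curve**: `γ.curve` is injective on `[0, ℓ + 1]` (two points with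
the same image lie on edges `j ≤ k`; if `j = k` the affine parametrisation is injective, and if
`j < k` the common point is a common endpoint of two edges of `G`, forcing `k = j + 1` and the
point to be the shared vertex, `mem_endpoints_of_mem_peanoEdge_inter` with `nodup`). [cite: LawlerSchrammWerner2004, §4.1] -/
theorem injOn_curve : InjOn γ.curve (Icc (0 : ℝ) γ.tlen) := by
  have hlen := γ.length_verts_eq
  -- edge index for closed times
  have hidx : ∀ s ∈ Icc (0 : ℝ) γ.tlen, ∃ k : ℕ, k + 1 < γ.verts.length ∧ s ∈ Icc (k : ℝ) (k + 1) := by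
    intro s hs
    rcases hs.2.lt_or_eq with hlt | heq
    · rcases hs.1.eq_or_lt with h0 | h0
      · refine ⟨0, by have := γ.two_le_length; omega, ?_⟩
        rw [← h0]; exact ⟨by simp, by simp⟩
      · exact γ.exists_edge_index ⟨h0, hlt⟩
    · refine ⟨γ.tlen - 1, by have := γ.tlen_pos; omega, ?_⟩
      have : ((γ.tlen - 1 : ℕ) : ℝ) = γ.tlen - 1 := by
        rw [Nat.cast_sub (γ.tlen_pos), Nat.cast_one]
      rw [heq, this]
      exact ⟨by linarith, by linarith⟩
  -- the symmetric core: indices `j ≤ k`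
  suffices key : ∀ s ∈ Icc (0 : ℝ) γ.tlen, ∀ s' ∈ Icc (0 : ℝ) γ.tlen, ∀ j k : ℕ,
      ∀ (hj : j + 1 < γ.verts.length) (hk : k + 1 < γ.verts.length),
      s ∈ Icc (j : ℝ) (j + 1) → s' ∈ Icc (k : ℝ) (k + 1) → j ≤ k → γ.curve s = γ.curve s' → s = s' by
    intro s hs s' hs' heq
    obtain ⟨j, hj, hsj⟩ := hidx s hs
    obtain ⟨k, hk, hsk⟩ := hidx s' hs'
    rcases le_total j k with hjk | hkj
    · exact key s hs s' hs' j k hj hk hsj hsk hjk heq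
    · exact (key s' hs' s hs k j hk hj hsk hsj hkj heq.symm).symm
  intro s _ s' _ j k hj hk hsj hsk hjk heq
  have hz : γ.curve s ∈ segment ℝ (peanoPt γ.verts[j]) (peanoPt γ.verts[j + 1]) := γ.curve_mem_segment hj hsj
  have hz' : γ.curve s ∈ segment ℝ (peanoPt γ.verts[k]) (peanoPt γ.verts[k + 1]) :=
    heq ▸ γ.curve_mem_segment hk hsk
  rcases hjk.eq_or_lt with rfl | hlt
  · -- same edge: the parametrisation is injective
    have h1 := γ.curve_eq_lineMap hj hsj
    have h2 := γ.curve_eq_lineMap hj hsk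
    rw [heq, h2] at h1
    have hne := γ.peanoPt_getElem_ne hj
    have : s' - j = s - j := by
      have h3 : (s' - j : ℝ) • (peanoPt γ.verts[j + 1] - peanoPt γ.verts[j]) =
          (s - j : ℝ) • (peanoPt γ.verts[j + 1] - peanoPt γ.verts[j]) := by
        simp only [AffineMap.lineMap_apply_module', add_left_inj] at h1
        exact h1
      exact smul_left_injective ℝ (sub_ne_zero.2 hne.symm) h3
    linarith
  · -- distinct edges: common endpoint
    have hinj : ∀ {i i' : ℕ} (hi : i < γ.verts.length) (hi' : i' < γ.verts.length),
        peanoPt γ.verts[i] = peanoPt γ.verts[i'] → i = i' := fun hi hi' h ↦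
      (γ.nodup.getElem_inj_iff).1 (peanoPt_injective h)
    rcases mem_endpoints_of_mem_peanoEdge_inter (γ.manhattan_getElem hj) (γ.manhattan_getElem hk) hz hz' with
      ⟨h1 | h1, h2 | h2⟩ | hset
    · exact absurd (hinj (by omega) (by omega) (h1.symm.trans h2)) (by omega)
    · exact absurd (hinj (by omega) (by omega) (h1.symm.trans h2)) (by omega)
    · -- `z = w_{j+1} = w_k`: `k = j + 1`, `s = j + 1 = k = s'`
      have hkj : j + 1 = k := hinj (by omega) (by omega) (h1.symm.trans h2)
      have hs1 : s = j + 1 := by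
        rw [γ.curve_eq_lineMap hj hsj] at h1
        have := eq_one_of_lineMap_eq_right (γ.peanoPt_getElem_ne hj) h1
        linarith
      have hs2 : s' = k := by
        rw [heq, γ.curve_eq_lineMap hk hsk] at h2
        have := eq_zero_of_lineMap_eq_left (γ.peanoPt_getElem_ne hk) h2
        linarith
      rw [hs1, hs2, ← hkj]; push_cast; ring
    · exact absurd (hinj (by omega) (by omega) (h1.symm.trans h2)) (by omega)
    · -- same edge as sets: impossible for `j < k`
      exfalso
      have hmem : γ.verts[j] ∈ ({γ.verts[k], γ.verts[k + 1]} : Set (ℤ × ℤ)) := by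
        rw [← hset]; exact mem_insert _ _
      rcases hmem with h | h
      · have := (γ.nodup.getElem_inj_iff).1 h; omega
      · have := (γ.nodup.getElem_inj_iff).1 (mem_singleton_iff.1 h); omega

/-- **The local picture at `b`.** There are `ρ ≠ 0` (the connecting vector `β_b - α_b`), a
direction `d` with `im d > 0`, and the radius `r = ¼` such that: the open half-disc
`b + ρ (B(0, r) ∩ ℍ)` lies in `D` (it is connected, misses `∂D` — frontier points within `¼` of
`b` lie on the diagonal, `im_mul_conj_eq_zero_of_mem_frontier_near_b` — and contains the final
points of the path, which are in `D` and strictly on the arrival side of the diagonal,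
`im_manhattan_step_mul_conj_diag_target`); its diameter `b + ρ(-r, r)` lies on
`[α_b, b] ∪ [b, β_b] ⊆ ∂D` and stays away from `a`; and on `[ℓ, ℓ + 1]` the path is the segment
`γ(s) = b + ρ ((ℓ + 1 - s) d)`, `d = (w_ℓ - b)/ρ`. [cite: LawlerSchrammWerner2004, §4.1] -/
theorem exists_halfDisc_at_b :
    ∃ (ρ d : ℂ) (r : ℝ), ρ ≠ 0 ∧ 0 < r ∧ 0 < d.im ∧
      (∀ z : ℂ, ‖z‖ < r → 0 < z.im → peanoPt Δ.b + ρ * z ∈ Δ.carrier) ∧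
      (∀ x : ℝ, |x| < r → peanoPt Δ.b + ρ * x ∈ frontier Δ.carrier) ∧
      (∀ x : ℝ, |x| < r → peanoPt Δ.b + ρ * x ≠ peanoPt Δ.a) ∧
      ∀ s ∈ Icc ((γ.tlen : ℝ) - 1) γ.tlen, γ.curve s = peanoPt Δ.b + ρ * ((((γ.tlen : ℝ) - s : ℝ) : ℂ) * d) := by
  have hlen := γ.length_verts_eq
  have htl := γ.tlen_pos
  set pb : ℂ := peanoPt Δ.b with hpb
  set ρ : ℂ := dualPt (dualNbr Δ.b) - primalPt (primalNbr Δ.b) with hρ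
  have hρ0 : ρ ≠ 0 := dualPt_sub_primalPt_ne_zero Δ.b
  have hnρ : Complex.normSq ρ = 1 / 2 := normSq_dualPt_sub_primalPt Δ.b
  have hρconj : ρ * conj ρ = ((1 / 2 : ℝ) : ℂ) := by rw [Complex.mul_conj, hnρ]
  have hnormρ : ‖ρ‖ < 1 := by
    have : ‖ρ‖ ^ 2 = 1 / 2 := by rw [← Complex.normSq_eq_norm_sq, hnρ]
    nlinarith [norm_nonneg ρ]
  -- the last edge `w_ℓ → b`
  have hk : (γ.tlen - 1) + 1 < γ.verts.length := by omega
  set wl : ℤ × ℤ := γ.verts[γ.tlen - 1] with hwl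
  have hlast : γ.verts[γ.tlen - 1 + 1]'hk = Δ.b := by
    rw [← γ.getElem_tlen]; exact getElem_congr_idx (by omega)
  have hM : Manhattan wl Δ.b := by
    have := γ.manhattan_getElem hk
    rwa [hlast] at this
  set d : ℂ := (peanoPt wl - pb) / ρ with hd
  have hρd : ρ * d = peanoPt wl - pb := by rw [hd]; field_simp
  have hdim : 0 < d.im := by
    have h1 : d = (peanoPt wl - pb) * conj ρ / ((1 / 2 : ℝ) : ℂ) := by
      rw [hd, div_eq_div_iff hρ0 (by norm_num), mul_assoc, mul_comm (conj ρ), hρconj]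
    rw [h1, div_ofReal_im, im_manhattan_step_mul_conj_diag_target hM]
    norm_num
  have hnd : ‖d‖ = ‖ρ‖⁻¹ * (1 / 2) := by
    rw [hd, norm_div, ← dist_eq_norm, dist_peanoPt_of_manhattan hM]
    ring
  -- the curve on the last edge
  have hcast : ((γ.tlen - 1 : ℕ) : ℝ) = γ.tlen - 1 := by rw [Nat.cast_sub htl, Nat.cast_one]
  have hcurve : ∀ s ∈ Icc ((γ.tlen : ℝ) - 1) γ.tlen,
      γ.curve s = pb + ρ * ((((γ.tlen : ℝ) - s : ℝ) : ℂ) * d) := by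
    intro s hs
    have hs' : s ∈ Icc (((γ.tlen - 1 : ℕ) : ℕ) : ℝ) (((γ.tlen - 1 : ℕ) : ℕ) + 1) := by
      rw [hcast]; exact ⟨hs.1, by linarith [hs.2]⟩
    rw [γ.curve_eq_lineMap hk hs', hlast, AffineMap.lineMap_apply_module', Complex.real_smul, hcast,
      ← mul_assoc, mul_comm ρ, mul_assoc, hρd]
    push_cast
    ring
  -- points of the last edge near `b` are in `D`
  have hin_edge : ∀ τ : ℝ, 0 < τ → τ < 1 → pb + ρ * ((τ : ℂ) * d) ∈ Δ.carrier := by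
    intro τ hτ0 hτ1
    have hs : (γ.tlen : ℝ) - τ ∈ Icc ((γ.tlen : ℝ) - 1) γ.tlen := ⟨by linarith, by linarith⟩
    have h1 := hcurve _ hs
    rw [show (γ.tlen : ℝ) - ((γ.tlen : ℝ) - τ) = τ by ring] at h1
    rw [← h1]
    have htlr : (1 : ℝ) ≤ γ.tlen := by exact_mod_cast htl
    exact γ.curve_mem_carrier ⟨by linarith, by linarith⟩
  refine ⟨ρ, d, 1 / 4, hρ0, by norm_num, hdim, ?_, ?_, ?_, hcurve⟩
  · -- the open half-disc is in `D`
    intro z hz hzim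
    set H : Set ℂ := (fun w : ℂ ↦ pb + ρ * w) '' (ball (0 : ℂ) (1 / 4) ∩ {w : ℂ | 0 < w.im}) with hH
    have hHc : IsPreconnected H := by
      refine ((convex_ball (0 : ℂ) (1 / 4)).inter (convex_halfSpace_im_gt 0)).isPreconnected.image _ ?_
      fun_prop
    have hHf : Disjoint H (frontier Δ.carrier) := by
      rw [Set.disjoint_left]
      rintro _ ⟨w, ⟨hw, hwim⟩, rfl⟩ hfr
      have hdist : dist (pb + ρ * w) pb < 1 / 4 := by
        rw [dist_eq_norm, add_sub_cancel_left, norm_mul]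
        have := mem_ball_zero_iff.1 hw
        nlinarith [norm_nonneg ρ, norm_nonneg w]
      have h0 := Δ.im_mul_conj_eq_zero_of_mem_frontier_near_b hfr hdist
      rw [add_sub_cancel_left, show ρ * w * conj ρ = (ρ * conj ρ) * w by ring, hρconj, im_ofReal_mul] at h0
      have : (0 : ℝ) < w.im := hwim
      nlinarith
    -- a point of the last edge inside the half-disc
    obtain ⟨τ, hτ0, hτ1, hτr⟩ : ∃ τ : ℝ, 0 < τ ∧ τ < 1 ∧ τ * ‖d‖ < 1 / 4 := by
      refine ⟨min (1 / 2) (1 / (8 * (‖d‖ + 1))), by positivity, by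
        linarith [min_le_left (1 / 2 : ℝ) (1 / (8 * (‖d‖ + 1)))], ?_⟩
      have hd0 : 0 ≤ ‖d‖ := norm_nonneg d
      calc min (1 / 2) (1 / (8 * (‖d‖ + 1))) * ‖d‖ ≤ 1 / (8 * (‖d‖ + 1)) * ‖d‖ :=
            mul_le_mul_of_nonneg_right (min_le_right _ _) hd0
        _ < 1 / 4 := by
            rw [div_mul_eq_mul_div, one_mul, div_lt_iff₀ (by positivity)]
            nlinarith
    have hmemH : pb + ρ * ((τ : ℂ) * d) ∈ H := by
      refine ⟨(τ : ℂ) * d, ⟨?_, ?_⟩, rfl⟩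
      · rw [mem_ball_zero_iff, norm_mul, norm_real, Real.norm_eq_abs, abs_of_pos hτ0]; exact hτr
      · show 0 < ((τ : ℂ) * d).im
        rw [im_ofReal_mul]; exact mul_pos hτ0 hdim
    have hsub := Δ.subset_carrier_of_isPreconnected hHc hHf hmemH (hin_edge τ hτ0 hτ1)
    exact hsub ⟨z, ⟨mem_ball_zero_iff.2 hz, hzim⟩, rfl⟩
  · -- the diameter is on the frontier
    intro x hx
    apply Δ.halfDiag_b_subset_frontier
    have hpr : primalPt (primalNbr Δ.b) = pb + ρ * (((-(1 / 2) : ℝ) : ℝ) : ℂ) := by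
      have := peanoPt_sub_primalPt_eq Δ.b
      rw [← hρ, ← hpb] at this
      push_cast
      linear_combination (-1 : ℂ) * this
    have hdu : dualPt (dualNbr Δ.b) = pb + ρ * ((((1 / 2) : ℝ) : ℝ) : ℂ) := by
      have := dualPt_sub_peanoPt_eq Δ.b
      rw [← hρ, ← hpb] at this
      push_cast
      linear_combination this
    rcases le_or_gt 0 x with hx0 | hx0
    · right
      rw [hdu, segment_eq_image_lineMap]
      refine ⟨2 * x, ⟨by linarith, by linarith [(abs_lt.1 hx).2]⟩, ?_⟩
      rw [AffineMap.lineMap_apply_module', Complex.real_smul]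
      push_cast
      ring
    · left
      rw [hpr, segment_symm, segment_eq_image_lineMap]
      refine ⟨-(2 * x), ⟨by linarith, by linarith [(abs_lt.1 hx).1]⟩, ?_⟩
      rw [AffineMap.lineMap_apply_module', Complex.real_smul]
      push_cast
      ring
  · -- the diameter avoids `a`
    intro x hx heq
    have h1 : dist (peanoPt Δ.a) pb < 1 / 4 := by
      rw [← heq, dist_eq_norm, add_sub_cancel_left, norm_mul, norm_real, Real.norm_eq_abs]
      nlinarith [norm_nonneg ρ, abs_nonneg x]
    have h2 : 1 / 4 ≤ dist (peanoPt Δ.a) pb := by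
      exact quarter_le_dist_peanoPt_of_mem_halfDiag Δ.a_ne_b.symm (abs_primalPt_sub_peanoPt Δ.a)
        (left_mem_segment ℝ _ _)
    linarith

end PeanoPath

end USTPeano

end Literature.Probability.RandomPlanarGeometry
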